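import Summits.MatrixMultiplication.OmegaCensus.DominoZpZpStructFourCore
import HarnessLib

/-!
# Structural cover argument for part size `5` on `ZMod p × ZMod p` (generic in the prime `p`): the core

ω-census `pub-omega`, family (b3), seat pub-omega-group gen 23.  Framing: lottery ticket; floor = certified bounds/negative
ranges.  VALUE: the part-`5` analogue of `DominoZpZpStructFourCore.lean` (gen 22): replaces the kernel ENUMERATION of all value
functions of sum `5` on `ZMod p × ZMod p` by a STRUCTURAL argument plus a tiny per-prime decide; the table side is
`DominoZpZpStructFive.lean`; NOT progress on ω.

Keys.  The count vector `key5 a` (length `p`, entry `v` = `#{i : aᵢ = v}`) of a quintuple `a : Fin 5 → ZMod p` of line values.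
A finite EXCLUDED list `E` of count vectors is given per prime (the repeated multisets of size `5` that pass the cyclotomic unit
test; for `p ∈ {13, 17, 19}` they number `156 / 128 / 108`, all of shape `2+1+1+1`).  Hypotheses on `E`, all decidable:
entries `≤ 2` and at most one entry `2` (`hE1`, `hE1'`: so a direction with TWO coincidences is never excluded), closure under
the unit scalings `v ↦ κv` (`hE2`, via `scaleVec`/`invMod`), and the PAIR PROPERTY `h3`: for value quintuples `x` (with `x₀ = x₁`) and
`y` (with `y₂ = y₃`) whose keys are excluded and which jointly separate the five indices, some pair `i ≠ j` has the combination
`k ↦ (yᵢ − yⱼ)·xₖ − (xᵢ − xⱼ)·yₖ` (the line values of the direction collapsing `i, j`) with a NON-excluded key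
(`DominoZpZpStructFiveCheck.lean` derives `h3` from a finite check over scaling representatives).

**Theorem (`exists_goodP`).**  Under these hypotheses every `u : Fin 5 → ZMod p × ZMod p` has, after a permutation `σ`, a
line direction `j ≤ p` with `ℓ(u_{σ0}) = ℓ(u_{σ1})` whose key is not excluded: a repeated point gives three equal values;
otherwise collapse `{0,1}` by `φ₁ = lmap w₂ (−w₁)` (`w = u₀ − u₁`); if it also collapses `{2,3}`, two coincidences; otherwise
`φ₁` and `φ₂` (collapsing `{2,3}`) separate the points and either one of the two keys is good or `h3` yields a pair `{i,j}` whose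
collapsing functional `(yᵢ−yⱼ)φ₁ − (xᵢ−xⱼ)φ₂` is non-zero with a good key; every non-zero functional is a unit multiple of some
`lineDir p j` (`exists_lineDir_of_lmap`) and keys of unit multiples are unit scalings (`key5_smul`).
-/

namespace Summit.MatrixMultiplication.OmegaCensus

open Finset

namespace ZpZpDomino

section Keys

/-- The count function of a quintuple of naturals: `#{i : nᵢ = v}`. [folklore] -/
def cnt5 (n₀ n₁ n₂ n₃ n₄ v : ℕ) : ℕ :=
  (if n₀ = v then 1 else 0) + (if n₁ = v then 1 else 0) + (if n₂ = v then 1 else 0) + (if n₃ = v then 1 else 0) +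
    (if n₄ = v then 1 else 0)

/-- The count VECTOR (length `p`, digits `≤ 5`) of a quintuple of naturals — the table key. [folklore] -/
def cv5 (p n₀ n₁ n₂ n₃ n₄ : ℕ) : List ℕ := (List.range p).map (cnt5 n₀ n₁ n₂ n₃ n₄)

/-- A modular inverse of `κ` mod `p` found by search (`0` if none). [folklore] -/
def invMod (p κ : ℕ) : ℕ := ((List.range p).find? fun v => κ * v % p == 1).getD 0

/-- The unit scaling `v ↦ κ·v` of a count vector: entry `w` of the result is entry `κ⁻¹·w` of `k`. [folklore] -/
def scaleVec (p κ : ℕ) (k : List ℕ) : List ℕ := (List.range p).map fun w => k.getD (invMod p κ * w % p) 0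

/-- `cnt5 ≤ 5`. [folklore] -/
theorem cnt5_le (n₀ n₁ n₂ n₃ n₄ v : ℕ) : cnt5 n₀ n₁ n₂ n₃ n₄ v ≤ 5 := by
  unfold cnt5; split_ifs <;> omega

/-- Length of a count vector. [folklore] -/
theorem length_cv5 (p n₀ n₁ n₂ n₃ n₄ : ℕ) : (cv5 p n₀ n₁ n₂ n₃ n₄).length = p := by simp [cv5]

/-- Entries of a count vector. [folklore] -/
theorem getD_cv5 (p n₀ n₁ n₂ n₃ n₄ : ℕ) {w : ℕ} (hw : w < p) :
    (cv5 p n₀ n₁ n₂ n₃ n₄).getD w 0 = cnt5 n₀ n₁ n₂ n₃ n₄ w := by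
  simp [cv5, List.getD_eq_getElem?_getD, List.getElem?_range hw]

variable {p : ℕ}

/-- The key (count vector of the values) of a quintuple of line values. [folklore] -/
def key5 (a : Fin 5 → ZMod p) : List ℕ := cv5 p (a 0).val (a 1).val (a 2).val (a 3).val (a 4).val

/-- The count function as a sum over `Fin 5`. [folklore] -/
theorem cnt5_key5_eq_sum (a : Fin 5 → ZMod p) (v : ℕ) :
    cnt5 (a 0).val (a 1).val (a 2).val (a 3).val (a 4).val v = ∑ i : Fin 5, if (a i).val = v then 1 else 0 := by
  simp only [cnt5, Fin.sum_univ_five]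

/-- Length of a key. [folklore] -/
theorem length_key5 (a : Fin 5 → ZMod p) : (key5 a).length = p := length_cv5 _ _ _ _ _ _

/-- Keys are invariant under permutations of the indices. [folklore] -/
theorem key5_perm (a : Fin 5 → ZMod p) (σ : Equiv.Perm (Fin 5)) : key5 (fun i => a (σ i)) = key5 a := by
  unfold key5 cv5
  refine List.map_congr_left fun v _ => ?_
  rw [cnt5_key5_eq_sum (fun i => a (σ i)), cnt5_key5_eq_sum a]
  exact Equiv.sum_comp σ (fun i => if (a i).val = v then 1 else 0)

/-- Entries of a key as a sum. [folklore] -/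
theorem getD_key5 (a : Fin 5 → ZMod p) {w : ℕ} (hw : w < p) :
    (key5 a).getD w 0 = ∑ i : Fin 5, if (a i).val = w then 1 else 0 := by
  rw [key5, getD_cv5 p _ _ _ _ _ hw, cnt5_key5_eq_sum]

variable [Fact p.Prime]

/-- Three distinct indices with the same value give an entry `≥ 3`. [folklore] -/
theorem three_le_getD_key5 (a : Fin 5 → ZMod p) {i j l : Fin 5} (hij : i ≠ j) (hil : i ≠ l) (hjl : j ≠ l)
    (e1 : a j = a i) (e2 : a l = a i) : 3 ≤ (key5 a).getD (a i).val 0 := by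
  rw [getD_key5 a (ZMod.val_lt _)]
  have h3 : ∑ k ∈ ({i, j, l} : Finset (Fin 5)), (if (a k).val = (a i).val then 1 else 0) = 3 := by
    rw [sum_insert (by simp [hij, hil]), sum_insert (by simp [hjl]), sum_singleton, e1, e2]
    simp
  exact le_trans (le_of_eq h3.symm) (sum_le_sum_of_subset_of_nonneg (subset_univ _) fun _ _ _ => Nat.zero_le _)

/-- Two indices with the same value give an entry `≥ 2`. [folklore] -/
theorem two_le_getD_key5 (a : Fin 5 → ZMod p) {i j : Fin 5} (hij : i ≠ j) (e1 : a j = a i) :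
    2 ≤ (key5 a).getD (a i).val 0 := by
  rw [getD_key5 a (ZMod.val_lt _)]
  have h2 : ∑ k ∈ ({i, j} : Finset (Fin 5)), (if (a k).val = (a i).val then 1 else 0) = 2 := by
    rw [sum_insert (by simp [hij]), sum_singleton, e1]
    simp
  exact le_trans (le_of_eq h2.symm) (sum_le_sum_of_subset_of_nonneg (subset_univ _) fun _ _ _ => Nat.zero_le _)

/-- Every index gives an entry `≥ 1`. [folklore] -/
theorem one_le_getD_key5 (a : Fin 5 → ZMod p) (i : Fin 5) : 1 ≤ (key5 a).getD (a i).val 0 := by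
  rw [getD_key5 a (ZMod.val_lt _)]
  have h1 : ∑ k ∈ ({i} : Finset (Fin 5)), (if (a k).val = (a i).val then 1 else 0) = 1 := by
    rw [sum_singleton, if_pos rfl]
  exact le_trans (le_of_eq h1.symm) (sum_le_sum_of_subset_of_nonneg (subset_univ _) fun _ _ _ => Nat.zero_le _)

/-- The entry of a key at one of its values is a member of the key (as a list). [folklore] -/
theorem getD_key5_mem (a : Fin 5 → ZMod p) (i : Fin 5) : (key5 a).getD (a i).val 0 ∈ key5 a := by
  have hw : (a i).val < (key5 a).length := by rw [length_key5]; exact ZMod.val_lt _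
  rw [List.getD_eq_getElem?_getD, List.getElem?_eq_getElem hw, Option.getD_some]
  exact List.getElem_mem hw

/-- **Three equal values ⇒ not excluded** (entries of excluded keys are `≤ 2`). [folklore] -/
theorem key5_not_mem_of_three {E : List (List ℕ)} (hE1 : ∀ k ∈ E, ∀ x ∈ k, x ≤ 2) (a : Fin 5 → ZMod p) {i j l : Fin 5}
    (hij : i ≠ j) (hil : i ≠ l) (hjl : j ≠ l) (e1 : a j = a i) (e2 : a l = a i) : key5 a ∉ E := by
  intro hmem
  have h3 := three_le_getD_key5 a hij hil hjl e1 e2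
  have hle := hE1 _ hmem _ (getD_key5_mem a i)
  omega

/-- **Two coincidences with different values ⇒ not excluded** (an excluded key has at most one entry `2`). [folklore] -/
theorem key5_not_mem_of_two_pairs {E : List (List ℕ)} (hE1 : ∀ k ∈ E, ∀ x ∈ k, x ≤ 2)
    (hE1' : ∀ k ∈ E, ∀ v < p, ∀ w < p, v ≠ w → k.getD v 0 = 2 → k.getD w 0 = 2 → False) (a : Fin 5 → ZMod p)
    {i j k l : Fin 5} (hij : i ≠ j) (hkl : k ≠ l) (e1 : a j = a i) (e2 : a l = a k) (hne : a i ≠ a k) :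
    key5 a ∉ E := by
  intro hmem
  have h2i := two_le_getD_key5 a hij e1
  have h2k := two_le_getD_key5 a hkl e2
  have hlei := hE1 _ hmem _ (getD_key5_mem a i)
  have hlek := hE1 _ hmem _ (getD_key5_mem a k)
  exact hE1' _ hmem _ (ZMod.val_lt _) _ (ZMod.val_lt _) (fun h => hne (ZMod.val_injective p h)) (by omega) (by omega)

/-- **Two coincidences ⇒ not excluded** (either three equal values or two entries `2`). [folklore] -/
theorem key5_not_mem_of_pairs {E : List (List ℕ)} (hE1 : ∀ k ∈ E, ∀ x ∈ k, x ≤ 2)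
    (hE1' : ∀ k ∈ E, ∀ v < p, ∀ w < p, v ≠ w → k.getD v 0 = 2 → k.getD w 0 = 2 → False) (a : Fin 5 → ZMod p)
    {i j k l : Fin 5} (hij : i ≠ j) (hkl : k ≠ l) (hik : i ≠ k) (hjk : j ≠ k)
    (e1 : a j = a i) (e2 : a l = a k) : key5 a ∉ E := by
  by_cases hne : a i = a k
  · exact key5_not_mem_of_three hE1 a hij hik hjk e1 hne.symm
  · exact key5_not_mem_of_two_pairs hE1 hE1' a hij hkl e1 e2 hne

/-- `invMod` is an inverse of a unit `κ` of `ZMod p`. [folklore] -/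
theorem natCast_invMod {κ : ZMod p} (hκ : κ ≠ 0) : ((invMod p κ.val : ℕ) : ZMod p) = κ⁻¹ := by
  unfold invMod
  have hsome : ∃ v, ((List.range p).find? fun v => κ.val * v % p == 1) = some v := by
    by_contra hnone
    push Not at hnone
    have hn : ((List.range p).find? fun v => κ.val * v % p == 1) = none := by
      cases h : (List.range p).find? (fun v => κ.val * v % p == 1) with
      | none => rfl
      | some v => exact absurd h (hnone v)
    rw [List.find?_eq_none] at hn
    have hv := hn (κ⁻¹).val (List.mem_range.2 (ZMod.val_lt _))
    apply hv
    rw [beq_iff_eq]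
    have e : ((κ.val * (κ⁻¹).val : ℕ) : ZMod p) = 1 := by
      rw [Nat.cast_mul, ZMod.natCast_zmod_val, ZMod.natCast_zmod_val, mul_inv_cancel₀ hκ]
    have := congrArg ZMod.val e
    rwa [ZMod.val_natCast, ZMod.val_one] at this
  obtain ⟨v, hv⟩ := hsome
  rw [hv, Option.getD_some]
  have hP := List.find?_some hv
  rw [beq_iff_eq] at hP
  have e : κ * ((v : ℕ) : ZMod p) = 1 := by
    have := congrArg (Nat.cast : ℕ → ZMod p) hP
    rw [ZMod.natCast_mod, Nat.cast_mul, ZMod.natCast_zmod_val, Nat.cast_one] at this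
    exact this
  rw [← mul_inv_cancel₀ hκ] at e
  exact mul_left_cancel₀ hκ e

/-- **Keys of unit multiples are unit scalings**: `key5 (κ·a) = scaleVec p κ.val (key5 a)`. [folklore] -/
theorem key5_smul {κ : ZMod p} (hκ : κ ≠ 0) (a : Fin 5 → ZMod p) :
    key5 (fun i => κ * a i) = scaleVec p κ.val (key5 a) := by
  unfold scaleVec
  rw [key5, cv5]
  refine List.map_congr_left fun w hw => ?_
  rw [List.mem_range] at hw
  have hidx : invMod p κ.val * w % p = (κ⁻¹ * ((w : ℕ) : ZMod p)).val := by
    have e : ((invMod p κ.val * w % p : ℕ) : ZMod p) = κ⁻¹ * ((w : ℕ) : ZMod p) := by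
      rw [ZMod.natCast_mod, Nat.cast_mul, natCast_invMod hκ]
    have := congrArg ZMod.val e
    rwa [ZMod.val_natCast, Nat.mod_mod] at this
  rw [hidx, key5, getD_cv5 p _ _ _ _ _ (ZMod.val_lt _)]
  unfold cnt5
  have hiff : ∀ i : Fin 5, ((κ * a i).val = w) ↔ ((a i).val = (κ⁻¹ * ((w : ℕ) : ZMod p)).val) := by
    intro i
    constructor
    · intro h
      have e : κ * a i = ((w : ℕ) : ZMod p) := by
        apply ZMod.val_injective p; rw [h, ZMod.val_natCast, Nat.mod_eq_of_lt hw]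
      rw [← e, inv_mul_cancel_left₀ hκ]
    · intro h
      have e : a i = κ⁻¹ * ((w : ℕ) : ZMod p) := by
        apply ZMod.val_injective p; rw [h]
      rw [e, mul_inv_cancel_left₀ hκ, ZMod.val_natCast, Nat.mod_eq_of_lt hw]
  simp only [hiff]

/-- **Scaling closure transfers non-membership**: if `E` is closed under unit scalings and `key5 a ∉ E`, then
`key5 (κ⁻¹·a)`-type statements follow; here in the form used below: `key5 (κ·a) ∈ E → key5 a ∈ E` for `κ ≠ 0`. [folklore] -/
theorem key5_mem_of_smul_mem {E : List (List ℕ)} (hE2 : ∀ k ∈ E, ∀ κ : ℕ, 1 ≤ κ → κ < p → scaleVec p κ k ∈ E)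
    {κ : ZMod p} (hκ : κ ≠ 0) (a : Fin 5 → ZMod p) (h : key5 (fun i => κ * a i) ∈ E) : key5 a ∈ E := by
  have hκ' : κ⁻¹ ≠ 0 := inv_ne_zero hκ
  have h1 := hE2 _ h (κ⁻¹).val (Nat.one_le_iff_ne_zero.2 ((ZMod.val_ne_zero _).2 hκ')) (ZMod.val_lt _)
  rw [← key5_smul hκ'] at h1
  have e : (fun i => κ⁻¹ * (κ * a i)) = a := funext fun i => by rw [inv_mul_cancel_left₀ hκ]
  rwa [e] at h1

/-- The converse transfer: `key5 a ∈ E → key5 (κ·a) ∈ E`. [folklore] -/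
theorem key5_smul_mem {E : List (List ℕ)} (hE2 : ∀ k ∈ E, ∀ κ : ℕ, 1 ≤ κ → κ < p → scaleVec p κ k ∈ E)
    {κ : ZMod p} (hκ : κ ≠ 0) (a : Fin 5 → ZMod p) (h : key5 a ∈ E) : key5 (fun i => κ * a i) ∈ E := by
  rw [key5_smul hκ]
  exact hE2 _ h κ.val (Nat.one_le_iff_ne_zero.2 ((ZMod.val_ne_zero _).2 hκ)) (ZMod.val_lt _)

end Keys

section Functionals

variable {p : ℕ} [Fact p.Prime]

/-- **`lmap c₁ c₂ = κ · lineDir p j`** for some direction `j ≤ p` and unit `κ`, whenever `(c₁, c₂) ≠ 0`. [folklore] -/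
theorem exists_lineDir_of_lmap (c₁ c₂ : ZMod p) (hc : c₁ ≠ 0 ∨ c₂ ≠ 0) :
    ∃ j < p + 1, ∃ κ : ZMod p, κ ≠ 0 ∧ ∀ v : ZMod p × ZMod p, lmap c₁ c₂ v = κ * lineDir p j v := by
  by_cases h2 : c₂ = 0
  · have h1 : c₁ ≠ 0 := hc.resolve_right (fun h => h h2)
    refine ⟨0, Nat.succ_pos p, c₁, h1, fun v => ?_⟩
    rw [lmap_apply, lineDir_zero_apply, h2, zero_mul, add_zero]
  · set k : ZMod p := c₁ * c₂⁻¹ with hk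
    refine ⟨k.val + 1, Nat.succ_lt_succ (ZMod.val_lt k), c₂, h2, fun v => ?_⟩
    have e : c₂ * (c₁ * c₂⁻¹) = c₁ := by rw [mul_comm, mul_assoc, inv_mul_cancel₀ h2, mul_one]
    rw [lmap_apply, lineDir_succ_apply, hk, mul_add, ← mul_assoc, e]

/-- The permutation of `Fin 5` sending `0 ↦ i`, `1 ↦ j` (for `i ≠ j`). [folklore] -/
def pairPerm (i j : Fin 5) : Equiv.Perm (Fin 5) := (Equiv.swap 1 (Equiv.swap 0 i j)).trans (Equiv.swap 0 i)

/-- Values of `pairPerm` at `0` and `1`. [folklore] -/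
theorem pairPerm_apply : ∀ i j : Fin 5, i ≠ j → pairPerm i j 0 = i ∧ pairPerm i j 1 = j := by decide

/-- The permutation `(0 2)(1 3)` of `Fin 5` (values `2, 3, 0, 1, 4`). [folklore] -/
def perm23 : Equiv.Perm (Fin 5) := (Equiv.swap (0 : Fin 5) 2).trans (Equiv.swap (1 : Fin 5) 3)

/-- Values of `perm23` at `0` and `1`. [folklore] -/
theorem perm23_apply : perm23 0 = 2 ∧ perm23 1 = 3 := by decide

/-- **From a good functional to a good direction.**  If the values `z k = lmap c₁ c₂ (u (σ k))` of a non-zero functional along a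
permuted configuration have `z (σ0) = z (σ1)` and the (unpermuted) key is not excluded, then some standard direction `j ≤ p` does too (`E` closed under
unit scalings). [folklore] -/
theorem good_of_lmap {E : List (List ℕ)} (hE2 : ∀ k ∈ E, ∀ κ : ℕ, 1 ≤ κ → κ < p → scaleVec p κ k ∈ E)
    (u : Fin 5 → ZMod p × ZMod p) (c₁ c₂ : ZMod p) (hc : c₁ ≠ 0 ∨ c₂ ≠ 0) (σ : Equiv.Perm (Fin 5))
    (hcoin : lmap c₁ c₂ (u (σ 0)) = lmap c₁ c₂ (u (σ 1))) (hkey : key5 (fun k => lmap c₁ c₂ (u k)) ∉ E) :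
    ∃ j < p + 1, ∃ σ : Equiv.Perm (Fin 5), lineDir p j (u (σ 0)) = lineDir p j (u (σ 1)) ∧
      key5 (fun i => lineDir p j (u (σ i))) ∉ E := by
  obtain ⟨j, hj, κ, hκ, hφ⟩ := exists_lineDir_of_lmap c₁ c₂ hc
  refine ⟨j, hj, σ, ?_, fun hmem => hkey ?_⟩
  · have := hcoin
    rw [hφ, hφ] at this
    exact (mul_right_inj' hκ).1 this
  · have e : (fun k => lmap c₁ c₂ (u (σ k))) = fun k => κ * lineDir p j (u (σ k)) := funext fun k => hφ _
    have h1 : key5 (fun k => lmap c₁ c₂ (u (σ k))) ∈ E := by rw [e]; exact key5_smul_mem hE2 hκ _ hmem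
    have h2 := key5_perm (fun k => lmap c₁ c₂ (u k)) σ
    rw [h2] at h1
    exact h1

end Functionals

section Core

variable {p : ℕ} [Fact p.Prime]

/-- Case of a repeated point `u 0 = u 1`: collapse `u 2` onto `u 0`; three values agree. [folklore] -/
theorem exists_goodP_of_eq {E : List (List ℕ)} (hE1 : ∀ k ∈ E, ∀ x ∈ k, x ≤ 2) (u : Fin 5 → ZMod p × ZMod p)
    (h01 : u 0 = u 1) :
    ∃ j < p + 1, ∃ σ : Equiv.Perm (Fin 5), lineDir p j (u (σ 0)) = lineDir p j (u (σ 1)) ∧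
      key5 (fun i => lineDir p j (u (σ i))) ∉ E := by
  obtain ⟨j, hj, e⟩ := exists_lineDir_eq (u 0) (u 2)
  refine ⟨j, hj, 1, by simp [h01], ?_⟩
  simp only [Equiv.Perm.coe_one, id_eq]
  exact key5_not_mem_of_three hE1 (fun i => lineDir p j (u i)) (i := 0) (j := 1) (l := 2) (by decide) (by decide)
    (by decide) (by simp [h01]) e.symm

/-- **The structural core for part `5`** (see the module docstring). [folklore] -/
theorem exists_goodP (E : List (List ℕ)) (hE1 : ∀ k ∈ E, ∀ x ∈ k, x ≤ 2)
    (hE1' : ∀ k ∈ E, ∀ v < p, ∀ w < p, v ≠ w → k.getD v 0 = 2 → k.getD w 0 = 2 → False)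
    (hE2 : ∀ k ∈ E, ∀ κ : ℕ, 1 ≤ κ → κ < p → scaleVec p κ k ∈ E)
    (h3 : ∀ x y : Fin 5 → ZMod p, x 0 = x 1 → key5 x ∈ E → y 2 = y 3 → key5 y ∈ E →
      (∀ i j : Fin 5, i ≠ j → (x i, y i) ≠ (x j, y j)) →
      ∃ i j : Fin 5, i ≠ j ∧ key5 (fun k => (y i - y j) * x k - (x i - x j) * y k) ∉ E)
    (u : Fin 5 → ZMod p × ZMod p) :
    ∃ j < p + 1, ∃ σ : Equiv.Perm (Fin 5), lineDir p j (u (σ 0)) = lineDir p j (u (σ 1)) ∧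
      key5 (fun i => lineDir p j (u (σ i))) ∉ E := by
  by_cases hinj : Function.Injective u
  swap
  · -- a repeated point
    rw [Function.Injective] at hinj
    push Not at hinj
    obtain ⟨i, i', e, hne⟩ := hinj
    obtain ⟨h0, h1⟩ := pairPerm_apply i i' hne
    obtain ⟨j, hj, σ, hσ⟩ := exists_goodP_of_eq hE1 (fun k => u (pairPerm i i' k)) (by
      show u (pairPerm i i' 0) = u (pairPerm i i' 1)
      rw [h0, h1, e])
    exact ⟨j, hj, σ.trans (pairPerm i i'), hσ⟩
  -- all points distinct: the functional collapsing `{0,1}`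
  set w₁ : ZMod p × ZMod p := u 0 - u 1 with hw₁
  have hu01 : u 0 ≠ u 1 := fun h => absurd (hinj h) (by decide)
  have hw₁ne : w₁ ≠ 0 := fun h => hu01 (sub_eq_zero.1 h)
  have hc₁ : w₁.2 ≠ 0 ∨ -w₁.1 ≠ 0 := by
    by_contra h
    push Not at h
    exact hw₁ne (Prod.ext (neg_eq_zero.1 h.2) h.1)
  set x : Fin 5 → ZMod p := fun i => lmap w₁.2 (-w₁.1) (u i) with hx
  have hx01 : x 0 = x 1 := by
    have : lmap w₁.2 (-w₁.1) (u 0) - lmap w₁.2 (-w₁.1) (u 1) = 0 := by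
      rw [← map_sub, ← hw₁, lmap_apply]; ring
    exact sub_eq_zero.1 this
  by_cases h23 : x 2 = x 3
  · -- `{2,3}` collapses too: two coincidences
    exact good_of_lmap hE2 u w₁.2 (-w₁.1) hc₁ (Equiv.refl _) hx01
      (key5_not_mem_of_pairs hE1 hE1' x (i := 0) (j := 1) (k := 2) (l := 3)
        (by decide) (by decide) (by decide) (by decide) hx01.symm h23.symm)
  -- the functional collapsing `{2,3}`; independence
  set w₂ : ZMod p × ZMod p := u 2 - u 3 with hw₂
  have hc₂ : w₂.2 ≠ 0 ∨ -w₂.1 ≠ 0 := by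
    by_contra h
    push Not at h
    have hw₂0 : w₂ = 0 := Prod.ext (neg_eq_zero.1 h.2) h.1
    have : u 2 = u 3 := sub_eq_zero.1 (hw₂ ▸ hw₂0)
    exact absurd (hinj this) (by decide)
  set y : Fin 5 → ZMod p := fun i => lmap w₂.2 (-w₂.1) (u i) with hy
  have hy23 : y 2 = y 3 := by
    have : lmap w₂.2 (-w₂.1) (u 2) - lmap w₂.2 (-w₂.1) (u 3) = 0 := by
      rw [← map_sub, ← hw₂, lmap_apply]; ring
    exact sub_eq_zero.1 this
  -- `D = φ₁(w₂) ≠ 0`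
  have hD : w₁.2 * w₂.1 - w₁.1 * w₂.2 ≠ 0 := by
    intro hD
    apply h23
    have : lmap w₁.2 (-w₁.1) (u 2) - lmap w₁.2 (-w₁.1) (u 3) = 0 := by
      rw [← map_sub, ← hw₂, lmap_apply]
      linear_combination hD
    exact sub_eq_zero.1 this
  -- `(φ₁, φ₂)` separates the points
  have hsep : ∀ i j : Fin 5, i ≠ j → (x i, y i) ≠ (x j, y j) := by
    intro i j hij e
    have ex : lmap w₁.2 (-w₁.1) (u i - u j) = 0 := by
      rw [map_sub]; exact sub_eq_zero.2 (congrArg Prod.fst e)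
    have ey : lmap w₂.2 (-w₂.1) (u i - u j) = 0 := by
      rw [map_sub]; exact sub_eq_zero.2 (congrArg Prod.snd e)
    set v := u i - u j with hv
    rw [lmap_apply] at ex ey
    have hv1 : (w₁.2 * w₂.1 - w₁.1 * w₂.2) * v.1 = 0 := by linear_combination w₂.1 * ex - w₁.1 * ey
    have hv2 : (w₁.2 * w₂.1 - w₁.1 * w₂.2) * v.2 = 0 := by linear_combination w₂.2 * ex - w₁.2 * ey
    have hvz : v = 0 := Prod.ext ((mul_eq_zero.1 hv1).resolve_left hD) ((mul_eq_zero.1 hv2).resolve_left hD)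
    exact hij (hinj (sub_eq_zero.1 hvz))
  by_cases hxE : key5 x ∈ E
  swap
  · exact good_of_lmap hE2 u w₁.2 (-w₁.1) hc₁ (Equiv.refl _) hx01 hxE
  by_cases hyE : key5 y ∈ E
  swap
  · refine good_of_lmap hE2 u w₂.2 (-w₂.1) hc₂ perm23 ?_ hyE
    rw [perm23_apply.1, perm23_apply.2]; exact hy23
  -- both keys excluded: the pair property
  obtain ⟨i, j, hij, hm⟩ := h3 x y hx01 hxE hy23 hyE hsep
  set α : ZMod p := y i - y j with hα
  set β : ZMod p := x i - x j with hβ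
  -- the collapsing functional `ψ = α φ₁ − β φ₂`
  have hψval : ∀ k, lmap (α * w₁.2 - β * w₂.2) (β * w₂.1 - α * w₁.1) (u k) = (y i - y j) * x k - (x i - x j) * y k := by
    intro k
    simp only [hx, hy, hα, hβ, lmap_apply]
    ring
  have hψne : (α * w₁.2 - β * w₂.2) ≠ 0 ∨ (β * w₂.1 - α * w₁.1) ≠ 0 := by
    by_contra h
    push Not at h
    obtain ⟨hc1, hc2⟩ := h
    have hαD : α * (w₁.2 * w₂.1 - w₁.1 * w₂.2) = 0 := by linear_combination w₂.1 * hc1 + w₂.2 * hc2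
    have hβD : β * (w₁.2 * w₂.1 - w₁.1 * w₂.2) = 0 := by linear_combination w₁.1 * hc1 + w₁.2 * hc2
    have hα0 : α = 0 := (mul_eq_zero.1 hαD).resolve_right hD
    have hβ0 : β = 0 := (mul_eq_zero.1 hβD).resolve_right hD
    exact hsep i j hij (Prod.ext (sub_eq_zero.1 hβ0) (sub_eq_zero.1 hα0))
  obtain ⟨h0, h1⟩ := pairPerm_apply i j hij
  refine good_of_lmap hE2 u _ _ hψne (pairPerm i j) ?_ ?_
  · rw [h0, h1, hψval, hψval]; ring
  · have e : (fun k => lmap (α * w₁.2 - β * w₂.2) (β * w₂.1 - α * w₁.1) (u k)) =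
        fun k => (y i - y j) * x k - (x i - x j) * y k := funext hψval
    rw [e]; exact hm

end Core

end ZpZpDomino

end Summit.MatrixMultiplication.OmegaCensus
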